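import Summits.BirchSwinnertonDyer.BirchSwinnertonDyer.Theorems.PrintCf2RamifiedOffTYZGenusPeriodKummerR2
import HarnessLib

/-!
# WORKFILE (crux stmt-BirchSwinnertonDyer-20509 `RamifiedOffTYZOfFacts`, line `offtyz-v7`, LEAD cruxlead-20509 g28, cycle 29) —
# LAW Z⁺: THE KUMMER CLASS OF THE GENUS PERIOD ON R2, AS A TYPED CONJECTURE, and its kernel reading «LAW Z⁺ ⟹ LAW Z's bit»

Status: CONJECTURES typed for the planner / the disprover / the next lead; `def … : Prop` only because this is a crux WORKFILE
(`Cruxes/RamifiedOffTYZOfFacts/Lines/`), never a Theorems/Literature proposal.  Nothing here is asserted.  Companion memo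
`Lines/offtyz_v7_KummerClass.md`; kernel `Theorems/PrintCf2RamifiedOffTYZGenusPeriodKummer.lean` (p795970); evidence `KUMMER-CLASS-R2-g28.md`
on item 20509 (census rows + fresh rows, exact arithmetic, 0 exceptions); instrument `zclass.py` (HOME `cruxlead-20509/g28/instruments/`).

R2 = {n = lq : l ≡ 1, q ≡ 7 (mod 8) primes, (l/q) = 1}; `ℍ′_{lq} = ℚ(i, √l, √−q)` (no divisor ≡ 5, 6 (mod 8)).  Objects of a pair (l, q):
* `π_l = a + b·i` with `a² + b² = l` — a Gaussian prime above `l` (either one: `π_l π̄_l = l` is a square in `ℍ′`);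
* `β_l = x + y·√−q` with `x² + q·y² = l·w²`, `w ≠ 0` — a RÉDEI GENERATOR: `ℚ(√l, √−q)(√β_l)` is the cyclic quartic unramified extension `H₁` of
  `K = ℚ(√−lq)` (the fixed field of `Cl(K)⁴`; any two choices differ by a square of `ℍ′` times a unit class absorbed below);
* g27's symbols `RedeiTwo l q` (`[2,l,q] = +1` ⟺ `[𝔭₂] ∈ Cl(K)⁴`, `𝔭₂ ∣ 2` the Heegner level prime) and `Delta l` (`δ(l)` ⟺ `l ≠ x² + 32y²` ⟺ `8 ∤ h(−4l)`).
LAW Z⁺ (this cycle): **`[X(Z(lq))] = 1` and `[X(Z(lq)) − 2i] = [π_l]^{[¬RedeiTwo]} · [β_l]^{[Delta]}` in `ℍ′^×/⟨ℍ′^{×2}, i⟩`** — i.e. the point `Z(lq)`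
becomes `2`-divisible modulo torsion exactly over `ℍ′`, `ℍ′(√π_l)` (= `ℍ′`·Rédei field of `−4l`), `ℍ′(√β_l)` (= `H₁(i)`), or `ℍ′(√(π_l β_l))`.
READING: the Kummer character of `Z(lq)` along the GAUSSIAN direction `√π_l` is the Rédei symbol `[l, −q, 2]` (= S, the Frobenius of the level prime in
`H₁/K`), and along the RÉDEI direction `√β_l` it is `[−4, l, 2]` (= ¬δ(l), the Frobenius of the ramified prime above 2 in the Rédei field of `ℚ(√−l)`) —
CROSSED.  g27's LAW Z (the bit) is the cell `RedeiTwo ∧ ¬Delta`.  BSD is not proved by any of this; 20509 / 23431 / 23432 OPEN.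
-/

noncomputable section

open scoped Classical

open WeierstrassCurve WeierstrassCurve.Affine WeierstrassCurve.Affine.Point
  Literature.NumberTheory.EllipticCurves Literature.NumberTheory.EllipticCurves.Rank1Residual
  Summit.BirchSwinnertonDyer.Rank1Residual
  Literature.NumberTheory.EllipticCurves.TianYuanZhang2017
  Literature.NumberTheory.EllipticCurves.TianYuanZhang2017.W2
  Summit.BirchSwinnertonDyer.PrintCf2.GenusPeriodKummer
  Summit.BirchSwinnertonDyer.PrintCf2.GenusPeriodKummerR2

set_option autoImplicit false

namespace Summit.BirchSwinnertonDyer.PrintCf2.LevelTwo.KummerClass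

/-! ## §1 The symbols (as in g27's workfile `offtyz_v7_RedeiLaws.lean`, restated here to keep the workfile self-contained) -/

/-- `[2, l, q] = +1` (g27): for `l = a² − 2b²`, `a > 0`, `r² = 2` in `ℤ/q`, `a + b r` is a square in `ℤ/q`. -/
def RedeiTwo (l q : ℕ) : Prop :=
  ∀ a b r : ℤ, (l : ℤ) = a ^ 2 - 2 * b ^ 2 → 0 < a → (r : ZMod q) ^ 2 = 2 → IsSquare ((a + b * r : ℤ) : ZMod q)

/-- The rank-zero digit `δ(l)`: `ord_{s=1} L(E_l, s) = 0 ∧ #Sel₄(E_l) = 2⁴` (⟺ `l ≠ x² + 32y²`). -/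
def Delta (l : ℕ) : Prop :=
  (congruentNumberCurve l).analyticRank = 0 ∧ Nat.card ((congruentNumberCurve l).selmerGroup 4) = 2 ^ 4

/-! ## §2 LAW Z⁺ and the independence datum (CONJECTURE / DISPLAY-GRADE FACT) -/

/-- **CONJECTURE LAW Z⁺ (the Kummer class of the genus period on R2).**  For primes `l ≡ 1`, `q ≡ 7 (mod 8)` with `(l/q) = 1` and
`ord_{s=1} L(E_{lq}, s) = 1`, on every display package `D` of `lq`, for every Gaussian decomposition `a² + b² = l` and every Rédei datum
`x² + q y² = l w²` (`w ≠ 0`): the descent class of `Z(lq)` at `(0,0)` is trivial, and its class at `(2i, 0)` is `[c]` or `[i·c]` with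
`c = (a + b i)^{[¬RedeiTwo l q]} · (x + y√−q)^{[Delta l]}`.  (Evidence: exact arithmetic, all decided census rows + fresh rows, 0 exceptions.) -/
def GenusPeriodKummerLawR2 : Prop :=
  ∀ (l q : ℕ), l.Prime → q.Prime → l % 8 = 1 → q % 8 = 7 → IsSquare ((l : ℤ) : ZMod q) →
    (congruentNumberCurve (l * q)).analyticRank = 1 →
    ∀ D : GenusPointData (l * q), D.Printed → D.CMPointCompositumPrinted → D.Thm35AtBlocks →
    ∀ (a b : ℤ), a ^ 2 + b ^ 2 = l → ∀ (x y w : ℤ), x ^ 2 + q * y ^ 2 = l * w ^ 2 → w ≠ 0 →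
      twoDescentComponent (curveA.baseChange D.H).toAffine 0 (2 * D.im) (-(2 * D.im)) (D.Z (l * q)) = 1 ∧
      (twoDescentComponent (curveA.baseChange D.H).toAffine (2 * D.im) 0 (-(2 * D.im)) (D.Z (l * q)) =
          sqClass ((if ¬ RedeiTwo l q then (a : D.H) + b * D.im else 1) *
            (if Delta l then (x : D.H) + y * D.sqrtNeg q else 1)) ∨
        twoDescentComponent (curveA.baseChange D.H).toAffine (2 * D.im) 0 (-(2 * D.im)) (D.Z (l * q)) =
          sqClass (D.im * ((if ¬ RedeiTwo l q then (a : D.H) + b * D.im else 1) *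
            (if Delta l then (x : D.H) + y * D.sqrtNeg q else 1))))

/-- **INDEPENDENCE DATUM (display-grade arithmetic of `ℍ′_{lq} = ℚ(i, √l, √−q)`).**  `ζ₈ ∉ ℍ′` (`[i] ≠ 1`), and the classes of `π_l`, `β_l`, `π_l β_l`
avoid `{1, [i]}` — i.e. `√2, √π_l, √(iπ_l), √β_l, √(iβ_l), √(π_lβ_l), √(iπ_lβ_l) ∉ ℍ′`.  (Instrument: true on every row; a finite check per row;
for the ABSTRACT display field `D.H` it is a hypothesis.) -/
def KummerIndependenceR2 : Prop :=
  ∀ (l q : ℕ), l.Prime → q.Prime → l % 8 = 1 → q % 8 = 7 → IsSquare ((l : ℤ) : ZMod q) →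
    ∀ D : GenusPointData (l * q), D.Printed → D.CMPointCompositumPrinted →
    ∀ (a b : ℤ), a ^ 2 + b ^ 2 = l → ∀ (x y w : ℤ), x ^ 2 + q * y ^ 2 = l * w ^ 2 → w ≠ 0 →
      sqClass D.im ≠ 1 ∧ ((a : D.H) + b * D.im ≠ 0) ∧ ((x : D.H) + y * D.sqrtNeg q ≠ 0) ∧
      (sqClass ((a : D.H) + b * D.im) ≠ 1 ∧ sqClass ((a : D.H) + b * D.im) ≠ sqClass D.im) ∧
      (sqClass ((x : D.H) + y * D.sqrtNeg q) ≠ 1 ∧ sqClass ((x : D.H) + y * D.sqrtNeg q) ≠ sqClass D.im) ∧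
      (sqClass (((a : D.H) + b * D.im) * ((x : D.H) + y * D.sqrtNeg q)) ≠ 1 ∧
        sqClass (((a : D.H) + b * D.im) * ((x : D.H) + y * D.sqrtNeg q)) ≠ sqClass D.im)

/-! ## §3 Kernel reading: LAW Z⁺ + independence ⟹ LAW Z's bit on every R2 row (via p795970) -/

/-- Existence of the auxiliary data: a Gaussian decomposition of a prime `l ≡ 1 (mod 4)` (Fermat) — taken as an input below (the instrument supplies
`a, b`; the tree's two-squares theorem could discharge it), and a Rédei datum `x² + q y² = l w²` (Legendre: solvable iff `(l/q) = (−q/l)… = 1`). -/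
theorem lawZ_bit_of_lawZPlus (hlaw : GenusPeriodKummerLawR2) (hind : KummerIndependenceR2)
    {l q : ℕ} (hl : l.Prime) (hq : q.Prime) (hl8 : l % 8 = 1) (hq8 : q % 8 = 7) (hlq : IsSquare ((l : ℤ) : ZMod q))
    (hr : (congruentNumberCurve (l * q)).analyticRank = 1)
    (D : GenusPointData (l * q)) (hPr : D.Printed) (hC : D.CMPointCompositumPrinted) (hBl : D.Thm35AtBlocks)
    {a b : ℤ} (hab : a ^ 2 + b ^ 2 = l) {x y w : ℤ} (hxy : x ^ 2 + q * y ^ 2 = l * w ^ 2) (hw : w ≠ 0) :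
    (∃ t : APoint D.H, IsOfFinAddOrder (D.Z (l * q) - (2 : ℤ) • t)) ↔ (RedeiTwo l q ∧ ¬ Delta l) := by
  have hodd : Odd (l * q) := by
    rw [Nat.odd_mul]; exact ⟨Nat.odd_iff.mpr (by omega), Nat.odd_iff.mpr (by omega)⟩
  obtain ⟨hi8, hp0, hb0, hp, hb, hpb⟩ := hind l q hl hq hl8 hq8 hlq D hPr hC a b hab x y w hxy hw
  have key := hlaw l q hl hq hl8 hq8 hlq hr D hPr hC hBl a b hab x y w hxy hw
  have h318 : D.lemma318 := hPr.2.2.2.2.2.2.2.2.1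
  have := twoDivisible_iff_cell_of_lawZPlus D hodd h318 hi8 (D.Z (l * q)) hp0 hb0 hp hb hpb
    (decide (¬ RedeiTwo l q)) (decide (Delta l)) (by simpa only [Bool.decide_eq_true, decide_eq_true_eq] using key)
  rw [this]
  simp only [decide_eq_false_iff_not, not_not]

/-! ## §4 (rev 2, cycle 29 part 2) The descent-side and second-digit laws found by `zgen.py` / `zlocal.py` (memo `Lines/offtyz_v7_KummerLaws.md`) -/

/-- `(q/l)₄ = +1` (g27's `FourthPower`; instrument dictionary rev 2: ⟺ the Rédei generator `β_l` is a square at the primes of `ℍ′` above `l`). -/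
def FourthPower (l q : ℕ) : Prop :=
  ∃ x : ZMod l, x ^ 4 = (q : ZMod l)

/-- **CONJECTURE LAW V⁺ (the visible class of the generator).**  For primes `l ≡ 1`, `q ≡ 7 (mod 8)`, `(l/q) = 1`, `ord_{s=1} L(E_{lq}, s) = 1`, on the cell
`¬δ(l) ∧ [2,l,q] = −1` (g27: the VISIBLE-special cell) every generator `h = (X, Y)` of `A_{lq}(ℚ)` modulo torsion has `X ∈ l·ℚ^{×2}` if `(q/l)₄ = +1` and
`X ∈ 2l·ℚ^{×2}` if `(q/l)₄ = −1`.  (Evidence: 15/15 + 10/10 census rows, `zgen.py`.)  A second-descent statement about `A_{lq}` over `ℚ`. -/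
def VisibleClassLawR2 : Prop :=
  ∀ (l q : ℕ), l.Prime → q.Prime → l % 8 = 1 → q % 8 = 7 → IsSquare ((l : ℤ) : ZMod q) →
    (congruentNumberCurve (l * q)).analyticRank = 1 → ¬ Delta l → ¬ RedeiTwo l q →
    ∀ {X Y : ℚ} (h : (Atwo (l * q)).toAffine.Nonsingular X Y),
      (∀ P : (Atwo (l * q)).toAffine.Point, ∃ m : ℤ, IsOfFinAddOrder (P - m • (Point.some X Y h : (Atwo (l * q)).toAffine.Point))) →
      (FourthPower l q → ∃ s : ℚ, X = l * s ^ 2) ∧ (¬ FourthPower l q → ∃ s : ℚ, X = 2 * l * s ^ 2)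

/-- **CONJECTURE (SECOND DIGIT, usable form).**  For primes `l ≡ 1`, `q ≡ 7 (mod 8)`, `(l/q) = 1`, `ord_{s=1} L(E_{lq}, s) = 1`, on the cell
`¬δ(l) ∧ [2,l,q] = +1 ∧ (q/l)₄ = −1` (the INVISIBLE cell), on every display package: the genus period `Z(lq)` has a half `W` modulo torsion whose FIRST
descent class `[X(W)]` is neither `1` nor `[i]` (instrument: `[X(W)] = [ω_K]`, a generator of the principal power of a Heegner level prime of `ℚ(√−lq)`;
11/11 rows).  Together with LAW Z⁺ (which gives the half) this is LAW Z's exact-depth clause on that cell. -/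
def SecondDigitLawR2 : Prop :=
  ∀ (l q : ℕ), l.Prime → q.Prime → l % 8 = 1 → q % 8 = 7 → IsSquare ((l : ℤ) : ZMod q) →
    (congruentNumberCurve (l * q)).analyticRank = 1 → ¬ Delta l → RedeiTwo l q → ¬ FourthPower l q →
    ∀ D : GenusPointData (l * q), D.Printed → D.CMPointCompositumPrinted → D.Thm35AtBlocks →
      ∃ W : APoint D.H, IsOfFinAddOrder (D.Z (l * q) - (2 : ℤ) • W) ∧
        twoDescentComponent (curveA.baseChange D.H).toAffine 0 (2 * D.im) (-(2 * D.im)) W ≠ 1 ∧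
        twoDescentComponent (curveA.baseChange D.H).toAffine 0 (2 * D.im) (-(2 * D.im)) W ≠ sqClass D.im

/-- **SECOND DIGIT ⟹ C⁺ on the invisible cell** (through p796596 `GenusPeriodKummerR2.levelTwo_of_half_class_of_invisible`): granted conjuncts 1, 2, 4, 5 of 𝔅_ram and
the display, on a row of the cell `¬δ(l) ∧ S ∧ ¬T` with an INVISIBLE generator (`X = 2s²`, which is LAW V on that cell), `SecondDigitLawR2` gives `2 ∥ L` for every
`L` with `𝓛(lq)² = L²`. -/
theorem levelTwo_invisible_of_secondDigit (hSD : SecondDigitLawR2)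
    (hGZK : rank_eq_analyticRank_of_analyticRank_le_one) (hmod : WeierstrassCurve.hasEntireLFunction_rat)
    (hCM0 : bsdTriple_of_hasCM_of_L_one_ne_zero) (h12 : thm12_parity_of_scriptL')
    {l q : ℕ} (hl : l.Prime) (hq : q.Prime) (hl8 : l % 8 = 1) (hq8 : q % 8 = 7) (hlq : IsSquare ((l : ℤ) : ZMod q))
    (hr : (congruentNumberCurve (l * q)).analyticRank = 1) (hδ : ¬ Delta l) (hS : RedeiTwo l q) (hT : ¬ FourthPower l q)
    (D : GenusPointData (l * q)) (hPr : D.Printed) (hC : D.CMPointCompositumPrinted) (hBl : D.Thm35AtBlocks)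
    {X Y : ℚ} (h : (Atwo (l * q)).toAffine.Nonsingular X Y) (hX : ∃ s : ℚ, X = 2 * s ^ 2)
    (hgen : ∀ P : (Atwo (l * q)).toAffine.Point, ∃ m : ℤ, IsOfFinAddOrder (P - m • (Point.some X Y h : (Atwo (l * q)).toAffine.Point))) :
    ∀ L : ℤ, IsScriptL (l * q) L → (2 : ℤ) ∣ L ∧ ¬ (4 : ℤ) ∣ L := by
  obtain ⟨W, hW, h1, hi⟩ := hSD l q hl hq hl8 hq8 hlq hr hδ hS hT D hPr hC hBl
  exact levelTwo_of_half_class_of_invisible hGZK hmod hCM0 h12 hl hq hl8 hq8 rfl hr D hPr hC hBl h hX hgen hδ hW h1 hi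

end Summit.BirchSwinnertonDyer.PrintCf2.LevelTwo.KummerClass

end
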